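import Literature.Topology.FourManifolds.SphereFamilySurgeryExistence
import Literature.Topology.FourManifolds.Morse
import Mathlib.Analysis.Calculus.BumpFunction.InnerProduct
import Mathlib.Analysis.InnerProductSpace.Calculus
import Mathlib.Geometry.Manifold.MFDeriv.SpecificFunctions
import HarnessLib

/-!
# The tube-radius function of a framed sphere: a smooth function on the ambient manifold whose
# small sublevel sets are the closed tubes `φ(Sᵏ × r Bˡ⁺¹)`, regular on the tubes

Topic `Literature/Topology/FourManifolds`; first brick of the "regular domain" presentation of
the complement of an open tube `M ∖ int φ(Sᵏ × ½Dˡ⁺¹)` — Kervaire–Milnor's `M₀` (M. Kervaire,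
J. Milnor, *Groups of homotopy spheres I*, Ann. of Math. (2) 77 (1963), Lemma 5.6, p. 514:
"`M₀ = M − Interior φ(Sᵏ × Dᵏ⁺¹)`") — as a compact smooth manifold with boundary via the tree's
regular sublevel sets (`RegularSublevelSet.lean`: Milnor 1965, Lemma 2.9; Lee 2013, Prop. 5.47,
"regular sublevel sets are regular domains"), needed for Poincaré–Lefschetz duality on `M₀`
(Kervaire–Milnor, proof of Lemma 5.6 and Lemma 5.8).

For a framed family `ν` with one sphere `φ : Sᵏ × ℝˡ⁺¹ ↪ M` (a smooth embedding with open image,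
`FramedSphereFamily`) this file constructs `ν.radiusFn : M → ℝ`:

* on the tube, `radiusFn (φ(u, w)) = β(w) ‖w‖² + (1 - β(w))` for a smooth bump `β` equal to `1`
  on `‖w‖ ≤ ¾` and supported in `‖w‖ < 1` (Mathlib's `ContDiffBump`), and `radiusFn = 1` off
  `φ(Sᵏ × D̄ˡ⁺¹)`; so `radiusFn (φ(u, w)) = ‖w‖²` for `‖w‖ ≤ ¾` (`radiusFn_apply_of_norm_le`) and
  `radiusFn > 9/16` elsewhere (`lt_radiusFn_of`);
* `contMDiff_radiusFn` — it is `C^∞` (the inverse of the tube is smooth on its open range,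
  `contMDiffOn_toHomeo_symm`; off the compact `φ(Sᵏ × D̄ˡ⁺¹)` the function is constant);
* `radiusFn_le_sq_iff`, `radiusFn_lt_sq_iff`, `radiusFn_eq_sq_iff` — for `0 < r ≤ ¾` the sets
  `{radiusFn ≤ r²}`, `{radiusFn < r²}`, `{radiusFn = r²}` are the closed tube `φ(Sᵏ × r D̄)`, the
  open tube and the level torus `φ(Sᵏ × r Sˡ)`;
* `not_isMCriticalPt_radiusFn` — `radiusFn` has no critical point on `φ(Sᵏ × (¾B ∖ 0))`
  (chain rule through the embedding; `d‖w‖²(w) = 2‖w‖² ≠ 0`).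

Everything is proved; the only definitions are the bump profile and the function itself.

## References

* M. Kervaire, J. Milnor, *Groups of homotopy spheres I*, Ann. of Math. (2) 77 (1963), Lemma 5.6
  (p. 514), Lemma 5.8. doi:10.2307/1970128 [KervaireMilnorAnnals1963]
* J. Milnor, *Lectures on the h-cobordism theorem* (1965), Lemma 2.9. [MilnorHCobordism1965]
* J. M. Lee, *Introduction to Smooth Manifolds*, 2nd ed. (2013), Prop. 5.47. [LeeSmoothManifolds2013]
-/

noncomputable section

open scoped Manifold ContDiff Topology
open Set Function Metric

namespace Literature.Topology.FourManifolds

/-- Local notation: `𝔼 n` is the model Euclidean space `EuclideanSpace ℝ (Fin n)`. -/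
local notation "𝔼 " n:arg => EuclideanSpace ℝ (Fin n)

/-- Local notation: `𝕊 n` is the unit sphere in `EuclideanSpace ℝ (Fin (n + 1))`. -/
local notation "𝕊 " n:arg => (Metric.sphere (0 : EuclideanSpace ℝ (Fin (n + 1))) 1)

namespace FramedSphereFamily

/-! ### The radial profile in the fibre -/

section Profile

variable (l : ℕ)

/-- The smooth bump of the fibre `ℝˡ⁺¹`: `1` on `‖w‖ ≤ ¾`, `0` for `‖w‖ ≥ 1`. [folklore] -/
def fibreBump : ContDiffBump (0 : 𝔼 (l + 1)) := ⟨3 / 4, 1, by norm_num, by norm_num⟩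

/-- **The radial profile** `β(w) ‖w‖² + (1 - β(w))`: `‖w‖²` on `‖w‖ ≤ ¾`, `1` for `‖w‖ ≥ 1`, and
`> 9/16` off `‖w‖ ≤ ¾`. [folklore] -/
def tubeProfile (w : 𝔼 (l + 1)) : ℝ := fibreBump l w * ‖w‖ ^ 2 + (1 - fibreBump l w)

/-- The profile is smooth. [folklore] -/
theorem contDiff_tubeProfile : ContDiff ℝ ∞ (tubeProfile l) :=
  ((fibreBump l).contDiff.mul (contDiff_norm_sq ℝ)).add (contDiff_const.sub (fibreBump l).contDiff)

variable {l}

/-- On `‖w‖ ≤ ¾` the profile is `‖w‖²`. [folklore] -/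
theorem tubeProfile_of_norm_le {w : 𝔼 (l + 1)} (hw : ‖w‖ ≤ 3 / 4) : tubeProfile l w = ‖w‖ ^ 2 := by
  have h1 : fibreBump l w = 1 :=
    (fibreBump l).one_of_mem_closedBall (by simpa [fibreBump] using hw)
  simp [tubeProfile, h1]

/-- For `‖w‖ ≥ 1` the profile is `1`. [folklore] -/
theorem tubeProfile_of_one_le_norm {w : 𝔼 (l + 1)} (hw : 1 ≤ ‖w‖) : tubeProfile l w = 1 := by
  have h0 : fibreBump l w = 0 := (fibreBump l).zero_of_le_dist (by simpa [fibreBump] using hw)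
  simp [tubeProfile, h0]

/-- Off `‖w‖ ≤ ¾` the profile exceeds `9/16`: it is a convex combination of `‖w‖² > 9/16` and
`1`. [folklore] -/
theorem lt_tubeProfile_of_lt_norm {w : 𝔼 (l + 1)} (hw : 3 / 4 < ‖w‖) : 9 / 16 < tubeProfile l w := by
  have hb0 : 0 ≤ fibreBump l w := (fibreBump l).nonneg
  have hb1 : fibreBump l w ≤ 1 := (fibreBump l).le_one
  have hw2 : 9 / 16 < ‖w‖ ^ 2 := by nlinarith [norm_nonneg w]
  unfold tubeProfile
  rcases le_or_gt (‖w‖ ^ 2) 1 with hs | hs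
  · -- `1 - β(1 - s) ≥ s`
    have h : fibreBump l w * (1 - ‖w‖ ^ 2) ≤ 1 - ‖w‖ ^ 2 :=
      mul_le_of_le_one_left (sub_nonneg.2 hs) hb1
    nlinarith
  · -- `1 + β(s - 1) ≥ 1`
    have h : 0 ≤ fibreBump l w * (‖w‖ ^ 2 - 1) := mul_nonneg hb0 (by linarith)
    nlinarith

/-- The profile is at least `min ‖w‖² 1`; in particular `tubeProfile w ≤ 9/16` forces `‖w‖ ≤ ¾`.
[folklore] -/
theorem norm_le_of_tubeProfile_le {w : 𝔼 (l + 1)} (h : tubeProfile l w ≤ 9 / 16) : ‖w‖ ≤ 3 / 4 := by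
  by_contra hw
  exact absurd h (not_le.2 (lt_tubeProfile_of_lt_norm (not_le.1 hw)))

end Profile

/-! ### The tube-radius function on the ambient manifold -/

section RadiusFn

variable {n k l : ℕ} {W : Type} [TopologicalSpace W]
  [ChartedSpace (EuclideanHalfSpace (n + 1)) W]
  (ν : FramedSphereFamily (𝓡∂ (n + 1)) W Unit k (l + 1))

/-- **The tube-radius function** of a framed sphere `φ = ν.toFun ()`: the radial profile of the
fibre coordinate on the tube, `1` off the tube. [cite: KervaireMilnorAnnals1963, Lemma 5.6 (p. 514)] -/
def radiusFn (x : W) : ℝ := by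
  classical
  exact if x ∈ range (ν.toFun ()) then tubeProfile l ((ν.toHomeo ()).symm x).2 else 1

/-- On the tube the radius function is the profile of the fibre coordinate. [folklore] -/
@[simp] theorem radiusFn_apply (q : (𝕊 k) × (𝔼 (l + 1))) :
    ν.radiusFn (ν.toFun () q) = tubeProfile l q.2 := by
  classical
  unfold radiusFn
  rw [if_pos (mem_range_self q), toHomeo_symm_apply]

/-- Off the tube the radius function is `1`. [folklore] -/
theorem radiusFn_of_not_mem {x : W} (hx : x ∉ range (ν.toFun ())) : ν.radiusFn x = 1 := by
  classical
  unfold radiusFn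
  rw [if_neg hx]

/-- On `φ(Sᵏ × ¾D̄)` the radius function is `‖w‖²`. [folklore] -/
theorem radiusFn_apply_of_norm_le {q : (𝕊 k) × (𝔼 (l + 1))} (hq : ‖q.2‖ ≤ 3 / 4) :
    ν.radiusFn (ν.toFun () q) = ‖q.2‖ ^ 2 := by
  rw [radiusFn_apply, tubeProfile_of_norm_le hq]

/-- Off `φ(Sᵏ × ¾D̄)` the radius function exceeds `9/16`. [folklore] -/
theorem lt_radiusFn_of {x : W} (hx : ∀ q : (𝕊 k) × (𝔼 (l + 1)), ‖q.2‖ ≤ 3 / 4 → ν.toFun () q ≠ x) :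
    9 / 16 < ν.radiusFn x := by
  by_cases hr : x ∈ range (ν.toFun ())
  · obtain ⟨q, rfl⟩ := hr
    rw [radiusFn_apply]
    exact lt_tubeProfile_of_lt_norm (not_le.1 fun h => hx q h rfl)
  · rw [ν.radiusFn_of_not_mem hr]; norm_num

/-- **The sublevel sets of the radius function below `9/16` are the closed tubes**: for
`0 < r ≤ ¾`, `radiusFn x ≤ r²` iff `x = φ(u, w)` with `‖w‖ ≤ r`. [folklore] -/
theorem radiusFn_le_sq_iff {r : ℝ} (hr0 : 0 < r) (hr : r ≤ 3 / 4) (x : W) :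
    ν.radiusFn x ≤ r ^ 2 ↔ ∃ q : (𝕊 k) × (𝔼 (l + 1)), ‖q.2‖ ≤ r ∧ ν.toFun () q = x := by
  have hr2 : r ^ 2 ≤ 9 / 16 := by nlinarith
  constructor
  · intro h
    by_cases hx : x ∈ range (ν.toFun ())
    · obtain ⟨q, rfl⟩ := hx
      rw [radiusFn_apply] at h
      have hq := norm_le_of_tubeProfile_le (h.trans hr2)
      rw [tubeProfile_of_norm_le hq] at h
      exact ⟨q, (pow_le_pow_iff_left₀ (norm_nonneg _) hr0.le two_ne_zero).1 h, rfl⟩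
    · rw [ν.radiusFn_of_not_mem hx] at h
      exact absurd (h.trans hr2) (by norm_num)
  · rintro ⟨q, hq, rfl⟩
    rw [ν.radiusFn_apply_of_norm_le (hq.trans hr)]
    exact pow_le_pow_left₀ (norm_nonneg _) hq 2

/-- **The open tubes**: for `0 < r ≤ ¾`, `radiusFn x < r²` iff `x = φ(u, w)` with `‖w‖ < r`.
[folklore] -/
theorem radiusFn_lt_sq_iff {r : ℝ} (hr0 : 0 < r) (hr : r ≤ 3 / 4) (x : W) :
    ν.radiusFn x < r ^ 2 ↔ ∃ q : (𝕊 k) × (𝔼 (l + 1)), ‖q.2‖ < r ∧ ν.toFun () q = x := by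
  have hr2 : r ^ 2 ≤ 9 / 16 := by nlinarith
  constructor
  · intro h
    by_cases hx : x ∈ range (ν.toFun ())
    · obtain ⟨q, rfl⟩ := hx
      rw [radiusFn_apply] at h
      have hq := norm_le_of_tubeProfile_le (h.le.trans hr2)
      rw [tubeProfile_of_norm_le hq] at h
      exact ⟨q, lt_of_pow_lt_pow_left₀ 2 hr0.le h, rfl⟩
    · rw [ν.radiusFn_of_not_mem hx] at h
      exact absurd (h.le.trans hr2) (by norm_num)
  · rintro ⟨q, hq, rfl⟩
    rw [ν.radiusFn_apply_of_norm_le (hq.le.trans hr)]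
    exact pow_lt_pow_left₀ hq (norm_nonneg _) two_ne_zero

/-- **The level tori**: for `0 < r ≤ ¾`, `radiusFn x = r²` iff `x = φ(u, w)` with `‖w‖ = r`.
[folklore] -/
theorem radiusFn_eq_sq_iff {r : ℝ} (hr0 : 0 < r) (hr : r ≤ 3 / 4) (x : W) :
    ν.radiusFn x = r ^ 2 ↔ ∃ q : (𝕊 k) × (𝔼 (l + 1)), ‖q.2‖ = r ∧ ν.toFun () q = x := by
  constructor
  · intro h
    obtain ⟨q, hq, rfl⟩ := (ν.radiusFn_le_sq_iff hr0 hr x).1 h.le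
    refine ⟨q, ?_, rfl⟩
    rw [ν.radiusFn_apply_of_norm_le (hq.trans hr)] at h
    exact (pow_left_inj₀ (norm_nonneg _) hr0.le two_ne_zero).1 h
  · rintro ⟨q, hq, rfl⟩
    rw [ν.radiusFn_apply_of_norm_le (hq.le.trans hr), hq]

/-! ### Smoothness -/

/-- The closed tube `φ(Sᵏ × D̄ˡ⁺¹)` is compact. [folklore] -/
theorem isCompact_image_closedTube :
    IsCompact (ν.toFun () '' {q : (𝕊 k) × (𝔼 (l + 1)) | ‖q.2‖ ≤ 1}) := by
  refine IsCompact.image ?_ (ν.continuous ())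
  have : {q : (𝕊 k) × (𝔼 (l + 1)) | ‖q.2‖ ≤ 1} = univ ×ˢ closedBall (0 : 𝔼 (l + 1)) 1 := by
    ext q; simp
  rw [this]
  exact isCompact_univ.prod (isCompact_closedBall _ _)

/-- Off the compact closed tube the radius function is constantly `1`. [folklore] -/
theorem radiusFn_eq_one_of_not_mem_closedTube {x : W}
    (hx : x ∉ ν.toFun () '' {q : (𝕊 k) × (𝔼 (l + 1)) | ‖q.2‖ ≤ 1}) : ν.radiusFn x = 1 := by
  by_cases hr : x ∈ range (ν.toFun ())
  · obtain ⟨q, rfl⟩ := hr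
    rw [radiusFn_apply]
    refine tubeProfile_of_one_le_norm (le_of_lt (not_le.1 fun h => hx ⟨q, h, rfl⟩))
  · exact ν.radiusFn_of_not_mem hr

variable [T2Space W]

/-- **The radius function is smooth.** On the open range of the tube it is the smooth profile of
the fibre coordinate of the smooth inverse of the tube (`contMDiffOn_toHomeo_symm`); off the
compact closed tube `φ(Sᵏ × D̄)` it is constant; the two open sets cover. [folklore] -/
theorem contMDiff_radiusFn : ContMDiff (𝓡∂ (n + 1)) 𝓘(ℝ, ℝ) ∞ ν.radiusFn := by
  apply contMDiff_of_locally_contMDiffOn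
  intro x
  by_cases hx : x ∈ ν.toFun () '' {q : (𝕊 k) × (𝔼 (l + 1)) | ‖q.2‖ ≤ 1}
  · -- near a point of the closed tube: inside the open range of `φ`
    refine ⟨range (ν.toFun ()), ν.isOpen_range (), image_subset_range _ _ hx, ?_⟩
    have hprof : ContMDiff ((𝓡 k).prod 𝓘(ℝ, 𝔼 (l + 1))) 𝓘(ℝ, ℝ) ∞
        (fun q : (𝕊 k) × (𝔼 (l + 1)) => tubeProfile l q.2) :=
      (contDiff_tubeProfile l).comp_contMDiff contMDiff_snd
    have h := hprof.comp_contMDiffOn (ν.contMDiffOn_toHomeo_symm ())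
    refine h.congr fun y hy => ?_
    obtain ⟨q, rfl⟩ := hy
    simp [Function.comp]
  · -- off the closed tube: constantly `1` on an open neighbourhood
    refine ⟨(ν.toFun () '' {q : (𝕊 k) × (𝔼 (l + 1)) | ‖q.2‖ ≤ 1})ᶜ,
      ν.isCompact_image_closedTube.isClosed.isOpen_compl, hx, ?_⟩
    refine (contMDiffOn_const (c := (1 : ℝ))).congr fun y hy => ?_
    exact ν.radiusFn_eq_one_of_not_mem_closedTube hy

/-- The radius function is continuous. [folklore] -/
theorem continuous_radiusFn : Continuous ν.radiusFn := ν.contMDiff_radiusFn.continuous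

/-! ### Regularity on the tubes -/

/-- **The radius function has no critical point on `φ(Sᵏ × (¾B ∖ 0))`.** Read through the tube,
`radiusFn ∘ φ = ‖w‖²` near `(u, w)`, whose derivative in the direction `(0, w)` is `2‖w‖² ≠ 0`;
by the chain rule a critical point of `radiusFn` at `φ(u, w)` would be one of `radiusFn ∘ φ`.
[cite: MilnorHCobordism1965, Lemma 2.9] -/
theorem not_isMCriticalPt_radiusFn [IsManifold (𝓡∂ (n + 1)) ∞ W] {q : (𝕊 k) × (𝔼 (l + 1))}
    (hq0 : q.2 ≠ 0) (hq : ‖q.2‖ < 3 / 4) :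
    ¬ IsMCriticalPt (𝓡∂ (n + 1)) ν.radiusFn (ν.toFun () q) := by
  intro hcrit
  -- the composite `radiusFn ∘ φ` has zero derivative at `q`
  have hφ : MDifferentiableAt ((𝓡 k).prod 𝓘(ℝ, 𝔼 (l + 1))) (𝓡∂ (n + 1)) (ν.toFun ()) q :=
    (ν.contMDiff ()).mdifferentiableAt (by simp)
  have hg : MDifferentiableAt (𝓡∂ (n + 1)) 𝓘(ℝ, ℝ) ν.radiusFn (ν.toFun () q) :=
    ν.contMDiff_radiusFn.mdifferentiableAt (by simp)
  have hcomp := mfderiv_comp q hg hφ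
  rw [show mfderiv (𝓡∂ (n + 1)) 𝓘(ℝ, ℝ) ν.radiusFn (ν.toFun () q) = 0 from hcrit,
    ContinuousLinearMap.zero_comp] at hcomp
  -- but near `q` it is `‖w‖²`, whose derivative at `q` along `(0, w)` is `2‖w‖²`
  have hev : (ν.radiusFn ∘ ν.toFun ()) =ᶠ[𝓝 q] fun p : (𝕊 k) × (𝔼 (l + 1)) => ‖p.2‖ ^ 2 := by
    have hO : IsOpen {p : (𝕊 k) × (𝔼 (l + 1)) | ‖p.2‖ < 3 / 4} :=
      isOpen_lt (continuous_norm.comp continuous_snd) continuous_const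
    filter_upwards [hO.mem_nhds hq] with p hp
    exact ν.radiusFn_apply_of_norm_le hp.le
  rw [hev.mfderiv_eq] at hcomp
  have hsnd : MDifferentiableAt ((𝓡 k).prod 𝓘(ℝ, 𝔼 (l + 1))) 𝓘(ℝ, 𝔼 (l + 1))
      (Prod.snd : (𝕊 k) × (𝔼 (l + 1)) → 𝔼 (l + 1)) q := mdifferentiableAt_snd
  have hsq : mfderiv ((𝓡 k).prod 𝓘(ℝ, 𝔼 (l + 1))) 𝓘(ℝ, ℝ)
      (fun p : (𝕊 k) × (𝔼 (l + 1)) => ‖p.2‖ ^ 2) q =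
      (fderiv ℝ (fun w : 𝔼 (l + 1) => ‖w‖ ^ 2) q.2).comp
        (mfderiv ((𝓡 k).prod 𝓘(ℝ, 𝔼 (l + 1))) 𝓘(ℝ, 𝔼 (l + 1))
          (Prod.snd : (𝕊 k) × (𝔼 (l + 1)) → 𝔼 (l + 1)) q) := by
    have h1 : MDifferentiableAt 𝓘(ℝ, 𝔼 (l + 1)) 𝓘(ℝ, ℝ) (fun w : 𝔼 (l + 1) => ‖w‖ ^ 2) q.2 :=
      ((contDiff_norm_sq ℝ (n := ∞)).differentiable (by simp)).differentiableAt.mdifferentiableAt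
    have h := mfderiv_comp q h1 hsnd
    rw [mfderiv_eq_fderiv] at h
    exact h
  rw [hsq, mfderiv_snd] at hcomp
  have happ := DFunLike.congr_fun hcomp ((0 : EuclideanSpace ℝ (Fin k)), q.2)
  change (fderiv ℝ (fun w : 𝔼 (l + 1) => ‖w‖ ^ 2) q.2) q.2 = (0 : ℝ) at happ
  have h2 : (fderiv ℝ (fun w : 𝔼 (l + 1) => ‖w‖ ^ 2) q.2) q.2 = 2 * ‖q.2‖ ^ 2 := by
    simp only [fderiv_norm_sq_apply, two_smul, FunLike.coe_add, Pi.add_apply,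
      innerSL_apply_apply, real_inner_self_eq_norm_sq]
    ring
  have hpos : 0 < ‖q.2‖ ^ 2 := by positivity
  rw [h2] at happ
  linarith

end RadiusFn

end FramedSphereFamily

end Literature.Topology.FourManifolds

end
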